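import Summits.QuantumAdvantage.AdviceFreeQNC0.LightDeviation
import HarnessLib

/-!
# Cell qa-qnc0 (rung F-Q1, density axis): the SYMMETRIC ORBIT-COUNTING ENGINE, part 1 — counting points of the
# cube by their weights in the four blocks cut out by two coordinate sets

Planner asks L30 / MIChainFifteen's existence conjunct (qa-qnc0-p1 ROUND-12 §2.10 (xi-n), (xi-w)): statements about
ALL codewords of the one-block eliminator code `C_m` (optimality of the symmetric word, `w(m,1)`, SC-margins) are not
`decide`-able point by point (`2^{2m+2}` codewords × `2^m` points) but reduce to binomial sums once points are counted
by ORBIT TYPE.  A codeword is a pair of affine forms `(S0, α0)`, `(S1, α1)` (part 2, `SymmetricCodewords.lean`); the two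
coordinate sets cut `Fin m` into four blocks (labels `(i ∈ S0, i ∈ S1)`), and everything about a point `u` that a
codeword or a symmetric pattern can see is the 4-tuple of its block weights.  This file proves the counting identity:

* `SymCount.card_fibre` / `card_fibre4` — the number of `u` with prescribed block weights `k` is `Π_bc C(#block bc, k bc)`
  (an explicit bijection with 4-tuples of subsets, `Finset.card_nbij'`);
* `SymCount.card_filter_eq_sum_box4` — hence `#{u : φ(block weights of u)} = Σ_k [φ k]·Π C(#block, k)`;
* `SymCount.G4` / `G4q` (`qchoose` = `Nat.choose` via descending factorials, kernel-friendly) and `sum_box4_eq_G4` — the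
  same sum with explicit block sizes `(p, q, r, s)`, `p + q + r + s = m` (`bs_sum`);
* `card_filter_S0`, `card_filter_S1`, `wt_eq_bw_sum` — `|u ∩ S0|`, `|u ∩ S1|`, `|u|` through the block weights.

Pure combinatorics; nothing here is specific to the quantum-advantage route beyond the vocabulary `wt`.
WHAT THIS IS NOT: no statement about `C_m` yet (part 2 and `SymmetricOptima.lean`); separation NOT moved.
-/

namespace Summit.QuantumAdvantage.AdviceFreeQNC0

open Finset

namespace SymCount

variable {m : ℕ}

/-- The label of coordinate `i` w.r.t. two coordinate sets `S0, S1`. -/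
def lab (S0 S1 : Finset (Fin m)) (i : Fin m) : Bool × Bool := (decide (i ∈ S0), decide (i ∈ S1))

/-- Block `bc`: the coordinates with label `bc`. -/
def block (S0 S1 : Finset (Fin m)) (bc : Bool × Bool) : Finset (Fin m) := univ.filter fun i => lab S0 S1 i = bc

/-- Block weights of `u`: number of `true` bits of `u` in each block. -/
def bw (S0 S1 : Finset (Fin m)) (u : Fin m → Bool) (bc : Bool × Bool) : ℕ :=
  ((block S0 S1 bc).filter fun i => u i = true).card

/-- Block weights are bounded by block sizes. -/
theorem bw_le (S0 S1 : Finset (Fin m)) (u : Fin m → Bool) (bc : Bool × Bool) :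
    bw S0 S1 u bc ≤ (block S0 S1 bc).card :=
  card_le_card (filter_subset _ _)

/-- **Fibre count**: the number of `u` with prescribed block weights `k` is `Π_bc C(#block bc, k bc)`. -/
theorem card_fibre (S0 S1 : Finset (Fin m)) (k : Bool × Bool → ℕ) :
    (univ.filter fun u : Fin m → Bool => ∀ bc, bw S0 S1 u bc = k bc).card =
      ∏ bc, ((block S0 S1 bc).card).choose (k bc) := by
  classical
  let t : Finset (Bool × Bool → Finset (Fin m)) :=
    Fintype.piFinset fun bc => powersetCard (k bc) (block S0 S1 bc)
  have ht : t.card = ∏ bc, ((block S0 S1 bc).card).choose (k bc) := by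
    rw [Fintype.card_piFinset]
    exact Finset.prod_congr rfl fun bc _ => card_powersetCard _ _
  rw [← ht]
  refine card_nbij' (fun u bc => (block S0 S1 bc).filter fun i => u i = true)
    (fun V i => decide (i ∈ V (lab S0 S1 i))) ?_ ?_ ?_ ?_
  · intro u hu
    rw [mem_coe, mem_filter] at hu
    rw [mem_coe, Fintype.mem_piFinset]
    intro bc
    rw [mem_powersetCard]
    exact ⟨filter_subset _ _, hu.2 bc⟩
  · intro V hV
    rw [mem_coe, Fintype.mem_piFinset] at hV
    rw [mem_coe, mem_filter]
    refine ⟨mem_univ _, fun bc => ?_⟩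
    obtain ⟨hsub, hcard⟩ := mem_powersetCard.1 (hV bc)
    rw [← hcard]
    unfold bw
    congr 1
    ext i
    simp only [mem_filter, decide_eq_true_eq]
    constructor
    · rintro ⟨hi, hiV⟩
      have hl : lab S0 S1 i = bc := (mem_filter.1 hi).2
      rwa [hl] at hiV
    · intro hiV
      have hi : i ∈ block S0 S1 bc := hsub hiV
      exact ⟨hi, by rwa [(mem_filter.1 hi).2]⟩
  · intro u _
    funext i
    have hi : i ∈ block S0 S1 (lab S0 S1 i) := mem_filter.2 ⟨mem_univ _, rfl⟩
    cases h : u i <;> simp [mem_filter, hi, h]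
  · intro V hV
    rw [mem_coe, Fintype.mem_piFinset] at hV
    funext bc
    ext i
    simp only [mem_filter, decide_eq_true_eq]
    constructor
    · rintro ⟨hi, hiV⟩
      rwa [(mem_filter.1 hi).2] at hiV
    · intro hiV
      have hi : i ∈ block S0 S1 bc := (mem_powersetCard.1 (hV bc)).1 hiV
      exact ⟨hi, by rwa [(mem_filter.1 hi).2]⟩

/-! ### Counting by block weights -/

/-- The four block weights as a tuple. -/
def bw4 (S0 S1 : Finset (Fin m)) (u : Fin m → Bool) : ℕ × ℕ × ℕ × ℕ :=
  (bw S0 S1 u (true, true), bw S0 S1 u (true, false), bw S0 S1 u (false, true), bw S0 S1 u (false, false))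

/-- Block sizes. -/
def bs (S0 S1 : Finset (Fin m)) (bc : Bool × Bool) : ℕ := (block S0 S1 bc).card

/-- From a 4-tuple back to a function on labels. -/
def tup (k : ℕ × ℕ × ℕ × ℕ) : Bool × Bool → ℕ
  | (true, true) => k.1
  | (true, false) => k.2.1
  | (false, true) => k.2.2.1
  | (false, false) => k.2.2.2

/-- The label-indexed block weight is the corresponding tuple component. -/
theorem bw_eq_tup_bw4 (S0 S1 : Finset (Fin m)) (u : Fin m → Bool) (bc : Bool × Bool) :
    bw S0 S1 u bc = tup (bw4 S0 S1 u) bc := by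
  rcases bc with ⟨_ | _, _ | _⟩ <;> rfl

/-- The box of admissible 4-tuples. -/
def box4 (S0 S1 : Finset (Fin m)) : Finset (ℕ × ℕ × ℕ × ℕ) :=
  range (bs S0 S1 (true, true) + 1) ×ˢ range (bs S0 S1 (true, false) + 1) ×ˢ
    range (bs S0 S1 (false, true) + 1) ×ˢ range (bs S0 S1 (false, false) + 1)

/-- Block-weight tuples lie in the box. -/
theorem bw4_mem_box4 (S0 S1 : Finset (Fin m)) (u : Fin m → Bool) : bw4 S0 S1 u ∈ box4 S0 S1 := by
  simp only [box4, bw4, mem_product, mem_range]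
  exact ⟨Nat.lt_succ_of_le (bw_le _ _ _ _), Nat.lt_succ_of_le (bw_le _ _ _ _),
    Nat.lt_succ_of_le (bw_le _ _ _ _), Nat.lt_succ_of_le (bw_le _ _ _ _)⟩

/-- The weight of one block-weight tuple: `Π_bc C(#block bc, k bc)`. -/
def wk (S0 S1 : Finset (Fin m)) (k : ℕ × ℕ × ℕ × ℕ) : ℕ :=
  (bs S0 S1 (true, true)).choose k.1 * (bs S0 S1 (true, false)).choose k.2.1 *
    (bs S0 S1 (false, true)).choose k.2.2.1 * (bs S0 S1 (false, false)).choose k.2.2.2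

/-- Fibre count, tuple form. -/
theorem card_fibre4 (S0 S1 : Finset (Fin m)) (k : ℕ × ℕ × ℕ × ℕ) :
    (univ.filter fun u : Fin m → Bool => bw4 S0 S1 u = k).card = wk S0 S1 k := by
  classical
  have h := card_fibre S0 S1 (tup k)
  have hset : (univ.filter fun u : Fin m → Bool => bw4 S0 S1 u = k) =
      (univ.filter fun u : Fin m → Bool => ∀ bc, bw S0 S1 u bc = tup k bc) := by
    ext u
    simp only [mem_filter, mem_univ, true_and]
    constructor
    · intro hu bc
      rw [bw_eq_tup_bw4, hu]
    · intro hu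
      rcases k with ⟨k1, k2, k3, k4⟩
      have h1 := hu (true, true); have h2 := hu (true, false)
      have h3 := hu (false, true); have h4 := hu (false, false)
      simp only [tup] at h1 h2 h3 h4
      simp only [bw4, h1, h2, h3, h4]
  rw [hset, h]
  -- the product over `Bool × Bool` is the 4-fold product
  rw [show (univ : Finset (Bool × Bool)) = {(true, true), (true, false), (false, true), (false, false)} from by decide]
  rw [prod_insert (by decide), prod_insert (by decide), prod_insert (by decide), prod_singleton]
  rcases k with ⟨k1, k2, k3, k4⟩
  simp only [wk, bs, tup]
  ring

/-- **Counting by block weights**: for a property of `u` that depends only on its four block weights. -/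
theorem card_filter_eq_sum_box4 (S0 S1 : Finset (Fin m)) (φ : ℕ × ℕ × ℕ × ℕ → Bool) :
    (univ.filter fun u : Fin m → Bool => φ (bw4 S0 S1 u) = true).card =
      ∑ k ∈ box4 S0 S1, if φ k = true then wk S0 S1 k else 0 := by
  classical
  rw [card_eq_sum_card_fiberwise (f := bw4 S0 S1) (t := box4 S0 S1) fun u _ => bw4_mem_box4 S0 S1 u]
  refine sum_congr rfl fun k _ => ?_
  by_cases hφ : φ k = true
  · rw [if_pos hφ, ← card_fibre4 S0 S1 k]
    congr 1
    ext u
    simp only [mem_filter, mem_univ, true_and]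
    constructor
    · exact fun h => h.2
    · intro h; exact ⟨by rw [h]; exact hφ, h⟩
  · rw [if_neg hφ, card_eq_zero]
    refine filter_eq_empty_iff.2 fun u hu => ?_
    intro h
    rw [mem_filter] at hu
    exact hφ (h ▸ hu.2)

/-! ### The arithmetic side -/

/-- `C(n,k)` through descending factorials (fast in the kernel; `= Nat.choose`). -/
def qchoose (n k : ℕ) : ℕ := n.descFactorial k / k.factorial

/-- `qchoose = Nat.choose`. -/
theorem qchoose_eq (n k : ℕ) : qchoose n k = n.choose k :=
  (Nat.choose_eq_descFactorial_div_factorial n k).symm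

/-- The block-weight sum with explicit block sizes (mathematical form). -/
def G4 (p q r s : ℕ) (φ : ℕ × ℕ × ℕ × ℕ → Bool) : ℕ :=
  ∑ k1 ∈ range (p + 1), ∑ k2 ∈ range (q + 1), ∑ k3 ∈ range (r + 1), ∑ k4 ∈ range (s + 1),
    if φ (k1, k2, k3, k4) = true then p.choose k1 * q.choose k2 * r.choose k3 * s.choose k4 else 0

/-- The same sum, hoisted and with `qchoose` (the form `decide` evaluates). -/
def G4q (p q r s : ℕ) (φ : ℕ × ℕ × ℕ × ℕ → Bool) : ℕ :=
  ∑ k1 ∈ range (p + 1), qchoose p k1 * ∑ k2 ∈ range (q + 1), qchoose q k2 *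
    ∑ k3 ∈ range (r + 1), qchoose r k3 * ∑ k4 ∈ range (s + 1), if φ (k1, k2, k3, k4) = true then qchoose s k4 else 0

/-- The hoisted form equals the plain form. -/
theorem G4q_eq (p q r s : ℕ) (φ : ℕ × ℕ × ℕ × ℕ → Bool) : G4q p q r s φ = G4 p q r s φ := by
  unfold G4q G4
  simp only [qchoose_eq, mul_sum]
  refine sum_congr rfl fun k1 _ => sum_congr rfl fun k2 _ => sum_congr rfl fun k3 _ =>
    sum_congr rfl fun k4 _ => ?_
  split_ifs <;> ring

/-- The box sum is `G4` of the block sizes. -/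
theorem sum_box4_eq_G4 (S0 S1 : Finset (Fin m)) (φ : ℕ × ℕ × ℕ × ℕ → Bool) :
    (∑ k ∈ box4 S0 S1, if φ k = true then wk S0 S1 k else 0) =
      G4 (bs S0 S1 (true, true)) (bs S0 S1 (true, false)) (bs S0 S1 (false, true)) (bs S0 S1 (false, false)) φ := by
  unfold box4 G4 wk
  rw [sum_product]
  refine sum_congr rfl fun k1 _ => ?_
  rw [sum_product]
  refine sum_congr rfl fun k2 _ => ?_
  rw [sum_product]

/-- The four block sizes add up to `m`. -/
theorem bs_sum (S0 S1 : Finset (Fin m)) :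
    bs S0 S1 (true, true) + bs S0 S1 (true, false) + bs S0 S1 (false, true) + bs S0 S1 (false, false) = m := by
  classical
  have h : ∑ bc : Bool × Bool, bs S0 S1 bc = m := by
    unfold bs block
    rw [← card_eq_sum_card_fiberwise (s := (univ : Finset (Fin m))) (t := (univ : Finset (Bool × Bool)))
      (f := lab S0 S1) fun _ _ => mem_univ _]
    simp
  rw [show (univ : Finset (Bool × Bool)) = {(true, true), (true, false), (false, true), (false, false)} from by decide,
    sum_insert (by decide), sum_insert (by decide), sum_insert (by decide), sum_singleton] at h
  omega

/-! ### Block weights vs. the affine data -/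

/-- `|u ∩ S0| = k_tt + k_tf`. -/
theorem card_filter_S0 (S0 S1 : Finset (Fin m)) (u : Fin m → Bool) :
    (S0.filter fun i => u i = true).card = bw S0 S1 u (true, true) + bw S0 S1 u (true, false) := by
  classical
  unfold bw block lab
  rw [← card_union_of_disjoint]
  · congr 1
    ext i
    simp only [mem_filter, mem_union, mem_univ, true_and, Prod.mk.injEq, decide_eq_true_eq,
      decide_eq_false_iff_not]
    by_cases h1 : i ∈ S1 <;> simp [h1]
  · rw [disjoint_left]
    intro i hi hi'
    simp only [mem_filter, mem_univ, true_and, Prod.mk.injEq] at hi hi'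
    rw [hi.1.2] at hi'
    exact absurd hi'.1.2 (by decide)

/-- `|u ∩ S1| = k_tt + k_ft`. -/
theorem card_filter_S1 (S0 S1 : Finset (Fin m)) (u : Fin m → Bool) :
    (S1.filter fun i => u i = true).card = bw S0 S1 u (true, true) + bw S0 S1 u (false, true) := by
  classical
  unfold bw block lab
  rw [← card_union_of_disjoint]
  · congr 1
    ext i
    simp only [mem_filter, mem_union, mem_univ, true_and, Prod.mk.injEq, decide_eq_true_eq,
      decide_eq_false_iff_not]
    by_cases h0 : i ∈ S0 <;> simp [h0]
  · rw [disjoint_left]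
    intro i hi hi'
    simp only [mem_filter, mem_univ, true_and, Prod.mk.injEq] at hi hi'
    rw [hi.1.1] at hi'
    exact absurd hi'.1.1 (by decide)

/-- `wt u = k_tt + k_tf + k_ft + k_ff`. -/
theorem wt_eq_bw_sum (S0 S1 : Finset (Fin m)) (u : Fin m → Bool) :
    wt u = bw S0 S1 u (true, true) + bw S0 S1 u (true, false) + bw S0 S1 u (false, true) +
      bw S0 S1 u (false, false) := by
  classical
  have h : wt u = ∑ bc : Bool × Bool, bw S0 S1 u bc := by
    unfold wt bw block
    rw [card_eq_sum_card_fiberwise (s := univ.filter fun i : Fin m => u i = true)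
      (t := (univ : Finset (Bool × Bool))) (f := lab S0 S1) fun _ _ => mem_univ _]
    refine sum_congr rfl fun bc _ => ?_
    congr 1; ext i; simp only [mem_filter, mem_univ, true_and]; tauto
  rw [h, show (univ : Finset (Bool × Bool)) = {(true, true), (true, false), (false, true), (false, false)} from
    by decide, sum_insert (by decide), sum_insert (by decide), sum_insert (by decide), sum_singleton]
  omega

end SymCount

end Summit.QuantumAdvantage.AdviceFreeQNC0
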